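import Summits.CriticalPhenomena.PercolationContinuityZ3.Theorems.Transplant.SkelFrmFrom1RootGlueQVK
import Summits.CriticalPhenomena.PercolationContinuityZ3.Theorems.Transplant.SkelFrmQuasiBChoiceDefsVPx
import Summits.CriticalPhenomena.PercolationContinuityZ3.Theorems.Transplant.SkelFrmFrom1ChoiceDefsPx
import Summits.CriticalPhenomena.PercolationContinuityZ3.Theorems.Transplant.PlanarSkeletonFrmQuasiDefs
import Summits.CriticalPhenomena.PercolationContinuityZ3.Theorems.Transplant.PlanarSkeletonFrmQuasiProxies
import Summits.CriticalPhenomena.PercolationContinuityZ3.Theorems.Transplant.SkelFrmQuasi1ChoiceDefs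
import Summits.CriticalPhenomena.PercolationContinuityZ3.Theorems.Transplant.SkelFrmQuasi1ParamsPO
import Summits.CriticalPhenomena.PercolationContinuityZ3.Theorems.Transplant.SkelFrmQuasiBChoiceDefsV
import Summits.CriticalPhenomena.PercolationContinuityZ3.Theorems.Transplant.SkelFrmQuasi1SlotTypes
import Summits.CriticalPhenomena.PercolationContinuityZ3.Theorems.Transplant.SkelPhiQStepsN
import HarnessLib

/-!
# GEN-Q PORT (WAVE-Q table v0.8 section 2, row G252, U-level L?; captain R-6/R-7 2026-08-27: carrier token swap `PlanarSkeletonFrmFrom ↦ PlanarSkeletonFrmQuasi`)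
# of the tree module «Transplant/SkelFrmFrom1RootGlueQVKPx» (sha256 a00c99daf72f43b7…) onto the quasi-step carrier `PlanarSkeletonFrmQuasi` (p507026): «SkelFrmQuasi1RootGlueQVKPx»

ORIGINAL TITLE: 

builds on p205010 (kernel theorem, internal audit signed; external expert review pending) — nothing in this file uses p205010; NOTHING is claimed about any open node
((N3-b), the end state).  Lane `prim-bschramm`, seat `prim-hp-8` (gen 62; GEN-Q pen, family BChoiceRoot*/1Root*/BParamsKit·Bridge; tool = captain gen-1 g4's port_genq.py R-14 + p3-g30 T1/T2 + stmt-g33 --force-keep).  Helper file (`--supports stmt-CriticalPhenomena-4575 --as helper`).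
PORT RULES (U-wave r1–r4 re-used, GEN-Q hunk classes of p3-g29 #6136): declaration order, names and proof texts are those of «SkelFrmFrom1RootGlueQVKPx», byte-identical except
(i) the carrier token `PlanarSkeletonFrmFrom ↦ PlanarSkeletonFrmQuasi` in binders, `namespace`/`end` lines and qualified names (module names `SkelFrmFrom… ↦ SkelFrmQuasi…`
in imports of already-ported rows); (ii) `Φ.step ↦ Φ.qstep` with the called Steps lemma replaced by its `…Q`/`_q` twin and the cost `Φ.M` threaded (none in this file unless
listed below); (iii) `Φ.cyl_connected ↦ Φ.cyl_reach` readers (none unless listed); (iv) graph-ball radii / window floors ×`Φ.M` (none unless listed).  Carrier-free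
residents stay imported/exported from the original «SkelFrm1RootGlueQVKPx» exactly as in the FrmFrom port.  Docstrings and citations are the original's.

K-2 (p3-g30, R-25 2026-08-27): no K-2 hunk needed in this file beyond the carrier swap; validated rc 0 kept whole over the staged closure.
-/

noncomputable section

open scoped Classical

namespace Summit.CriticalPhenomena.PercolationContinuityZ3.Theorems.Transplant

open MeasureTheory Literature.Probability.Percolation Literature.Probability.LatticeModels SimpleGraph KNCells KNLevels

namespace PlanarSkeletonFrmQuasi

open SkelConc (Consts)
open Skelφ.StepI (OutNS)
open Skel (winGraph)

/-- **THE GEN (R) COLUMN K-PROP AT RADIUS `D` FROM THE PER-AXIS ROOT LEGS** — GEN twin of `rootHoldsNQWFnLK_frmChoiceAllQ3V_of_axes`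
(«SkelFrmFrom1RootGlueQVK»): per-axis root legs at the Px choice data `NegB.choiceAtQ3VPx … D …` under `Φ.HasProxies t D` (in place of `Φ.types = {t}`) give
`RootHoldsNQWFnLKPxAt Lf Kmin (frmChoiceAllQ3VPx D gv fv Pv Sv cv hv bv)` (gen-1's forms of record, «SkelFrmFrom1ChoiceDefsPx» §2 / «SkelFrmFromBChoiceDefsVPx» §3);
proof = the U glue verbatim over `frmChoiceAllQ3VPx_eq/_scheme` and `Skel.rootOblTWF_of_axes`. [cite: KozmaNitzan2024, §4 p. 28 ((32) at the root)] -/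
theorem rootHoldsNQWFnLKPxAt_frmChoiceAllQ3VPx_of_axes (Lf : ℕ → ℕ) (Kmin D : ℕ) (gv fv : Neg.FSlot) (Pv : NegB.PSlot) (Sv : NegB.SSlot) (cv hv : NegB.CSlot) (bv : NegB.BSlot)
    (h : ∀ (κ : Consts) {V : Type} [DecidableEq V] [Countable V] (G : SimpleGraph V) [G.LocallyFinite] (Φ : PlanarSkeletonFrmQuasi G) (t : V) (p : unitInterval)
      (hC : Φ.CylSubcritical p) (O : OutNS V) (q : unitInterval), Kmin ≤ κ.K₀ → (NegB.choiceAtQ3VPx κ Φ t p D Pv gv fv Sv cv hv bv hC).AtQNQ O q →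
      Φ.HasProxies t D → 0 < (p : ℝ) → (p : ℝ) < 1 → FlatQ Lf κ → ∀ a : Fin 2,
      ∃ n, n ≤ Lf κ.K₀ ∧ ∃ (c : V) (Rπ : ℕ) (W : Sym2 V → unitInterval) (s : Fin (n + 1) → KNLevels.TStep (winGraph G c Rπ))
        (T' : Fin (n + 1) → Finset V) (η : ℝ),
        (∀ T : Finset V, (prodBernoulli W).real (⋃ t' ∈ T, openConn (NegB.ΓQV κ Φ t p O gv fv Sv cv hv bv q).root t') ≤
          (prodBernoulli (pinW (KNLevels.lattW G q) ↑((⟨NegB.ΓQV κ Φ t p O gv fv Sv cv hv bv q, q, κ.δ⟩ : KSchA V ℕ).U₀ G)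
            ↑((⟨NegB.ΓQV κ Φ t p O gv fv Sv cv hv bv q, q, κ.δ⟩ : KSchA V ℕ).U₀ G))).real
            (⋃ t' ∈ (↑T : Set V), openConnIn (↑((NegB.ΓQV κ Φ t p O gv fv Sv cv hv bv q).Q (NegB.ΓQV κ Φ t p O gv fv Sv cv hv bv q).a₀ 0 ∪
              (NegB.ΓQV κ Φ t p O gv fv Sv cv hv bv q).Ewv (NegB.ΓQV κ Φ t p O gv fv Sv cv hv bv q).a₀ 0 ((a, true) : MDir)) : Set V)
              (NegB.ΓQV κ Φ t p O gv fv Sv cv hv bv q).root t')) ∧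
        (∀ i : Fin (n + 1), (s i).L.o = (NegB.ΓQV κ Φ t p O gv fv Sv cv hv bv q).root) ∧
        (∀ i : Fin n, T' (Fin.castSucc i) ⊆ (s i.succ).L.X 0) ∧ (∀ i : Fin (n + 1), T' i ⊆ (s i).T) ∧
        (∀ i : Fin (n + 1), (s i).KitsAtF W q Φ.Δ (κ.δr 0)) ∧ η ≤ κ.δr 0 / 2 ∧
        (∀ i : Fin (n + 1), (prodBernoulli W).real (⋃ t' ∈ (s i).T \ T' i, openConn (NegB.ΓQV κ Φ t p O gv fv Sv cv hv bv q).root t') ≤ η) ∧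
        1 - κ.δr 0 < (prodBernoulli W).real (s 0).L.reachB ∧
        T' (Fin.last n) ⊆ (NegB.ΓQV κ Φ t p O gv fv Sv cv hv bv q).M (NegB.ΓQV κ Φ t p O gv fv Sv cv hv bv q).a₀ ((0 : Site 2) + stepVec ((a, true) : MDir))) :
    RootHoldsNQWFnLKPxAt Lf Kmin (frmChoiceAllQ3VPx D gv fv Pv Sv cv hv bv) := by
  intro κ V _ _ G _ Φ hg t ht hP p hp0 hp1 hC hK hflat O q hAt
  rw [frmChoiceAllQ3VPx_eq] at hAt
  rw [frmChoiceAllQ3VPx_scheme]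
  refine Skel.rootOblTWF_of_axes fun a => ?_
  obtain ⟨n, hn, c, Rπ, W, s, T', η, htr, ho, hlink, hsub, hkits, hη, hexc, hsrc, hlast⟩ := h κ G Φ t p hC O q hK hAt hP hp0 hp1 hflat a
  refine ⟨n, c, Rπ, W, s, T', η, htr, ho, hlink, hsub, ?_, ?_, hexc, ?_, hlast⟩
  · rw [hflat n hn]; exact hkits
  · rw [hflat n hn]; exact hη
  · rw [hflat n hn]; exact hsrc

end PlanarSkeletonFrmQuasi

end Summit.CriticalPhenomena.PercolationContinuityZ3.Theorems.Transplant

end
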